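import Literature.AnabelianGeometry.SemiGraphs.SgAToProfiniteHom
import Literature.AnabelianGeometry.SemiGraphs.TemperedReconstruction
import HarnessLib

/-!
# [SemiAnbd] Def. 3.5 (ii) on the arrows of the ambient category `SgA`: tempered arrows through the
# profinite presentation (bridge B4, DEFINITION layer)

Mochizuki, *Semi-graphs of anabelioids*, Publ. RIMS **42** (2006), Def. 3.5 p. 37 (kurims
`paper:url-f33ace170ff4`): (i) "a morphism of semi-graphs of anabelioids `𝒢' → 𝒢` that may be
constructed in this way [from an object of `B^cov(𝒢)`] … a covering"; (ii) "we shall say that the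
covering `𝒢' → 𝒢`, as well as the object of `B^cov(𝒢)` that gave rise to this covering, is
tempered" [cite: MochizukiSemiAnbd2006, Def 3.5(ii) p.37].

Step B4 (definition layer) of the (R1) bridge of the §§4–5 container (HOME/staging/L3/L3-t3/
R1-BRIDGE-SHAPES.md §1; interface owner abc-iut-L3-t3), over B1/B2 (`SgAToProfinite*.lean`) and
abc-iut-L3-t2/d6's `B^cov` (`CovObj`, `CovObj.IsTempered`, `CovObj.coveringGraph`,
`CovObj.coveringHom`, `TemperedCoverings.lean` / `TemperedReconstruction.lean`): an arrow `f : H ⟶ G`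
of `SgA` IS A TEMPERED COVERING OF `G` when, read on profinite presentations (B2 `HomOver.toProfinite`
of a representative 1-morphism), it is isomorphic OVER `G.toProfinite` to the covering
`S.coveringGraph → G.toProfinite` of some TEMPERED object `S` of `B^cov(G.toProfinite)` — ONE notion of
temperedness in the tree (t2's), transported, not a second definition:

* `ProfiniteSemiGraph.castGv` / `castGe` — transport in the families `Π_v`, `Π_e` along equalities;
* `ProfiniteSemiGraph.Hom.identity` — the identity morphism of a profinite presentation;
* `ProfiniteSemiGraph.Hom.IsoOver p q` — an isomorphism of profinite presentations OVER a base `P`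
  (base an isomorphism of semi-graphs, constituents bijective, compatible with the structure
  morphisms `p`, `q` up to inner automorphisms of the constituents of `P`, as Def. 5.1 (iv) / §3 read
  morphisms); `IsoOver.refl`;
* `SgAQuot.SgA.repHomOver f` — a representative 1-morphism of the arrow `f` (2-isomorphism class);
* `SgAQuot.SgA.IsTemperedCoveringOf f` — THE DEFINITION; `IsoOver.of_conj` /
  `isTemperedCoveringOf_indep` — independence of the representative (B2: 2-isomorphic 1-morphisms
  give conjugate homomorphisms).

NOT here (R1-BRIDGE-SHAPES.md §2, the two laws that turn this into `SgA.TemperedResidual.real`):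
finite étale ⇒ tempered (L1), tempered ⇒ locally finite étale (L2).  Definitions + bookkeeping only;
nothing of the paper is asserted; no side taken on [IUTchIII] Cor. 3.12.
-/

noncomputable section

namespace Literature.AnabelianGeometry.SemiGraphs

open CategoryTheory

universe u

namespace ProfiniteSemiGraph

variable {X Y P : ProfiniteSemiGraph.{u}}

/-! ### Transport in the families of constituent groups -/

/-- Transport in the family of vertex groups along an equality of vertices (an isomorphism of
topological groups; the identity on the nose after `subst`). [cite: MochizukiSemiAnbd2006, Def. 2.1 p.23] -/
def castGv (P : ProfiniteSemiGraph.{u}) {w w' : P.graph.Vertex} (h : w = w') : P.Gv w ≃ₜ* P.Gv w' := by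
  subst h; exact ContinuousMulEquiv.refl _

/-- Transport in the family of edge groups along an equality of edges. [cite: MochizukiSemiAnbd2006, Def. 2.1 p.23] -/
def castGe (P : ProfiniteSemiGraph.{u}) {e e' : P.graph.Edge} (h : e = e') : P.Ge e ≃ₜ* P.Ge e' := by
  subst h; exact ContinuousMulEquiv.refl _

/-- Transport along `rfl` is the identity. [cite: MochizukiSemiAnbd2006, Def. 2.1 p.23] -/
@[simp] theorem castGv_rfl (P : ProfiniteSemiGraph.{u}) (w : P.graph.Vertex) (x : P.Gv w) :
    P.castGv rfl x = x := rfl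

/-- Transport along `rfl` is the identity. [cite: MochizukiSemiAnbd2006, Def. 2.1 p.23] -/
@[simp] theorem castGe_rfl (P : ProfiniteSemiGraph.{u}) (e : P.graph.Edge) (x : P.Ge e) :
    P.castGe rfl x = x := rfl

/-! ### The identity morphism of a profinite presentation -/

/-- The identity morphism of a profinite presentation (identity of the underlying semi-graph,
identities on `Π_v`, `Π_e`; the branch squares commute on the nose).
[cite: MochizukiSemiAnbd2006, Def. 2.1 p.23] -/
def Hom.identity (X : ProfiniteSemiGraph.{u}) : Hom X X where
  base := 𝟙 X.graph
  hV v := ContinuousMonoidHom.id (X.Gv v)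
  hE e := ContinuousMonoidHom.id (X.Ge e)
  comm b v h := ⟨1, fun x => by rw [one_mul, inv_one, mul_one]; rfl⟩

/-- The identity morphism is locally trivial. [cite: MochizukiSemiAnbd2006, Def 2.2(ii) p.24] -/
theorem Hom.identity_isLocallyTrivial (X : ProfiniteSemiGraph.{u}) : (Hom.identity X).IsLocallyTrivial :=
  ⟨fun _ => Function.bijective_id, fun _ => Function.bijective_id⟩

/-! ### Isomorphisms over a base -/

/-- **An isomorphism OVER `P`** between profinite presentations `X`, `Y` with structure morphisms
`p : X → P`, `q : Y → P`: a morphism `X → Y` whose underlying morphism of semi-graphs is an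
isomorphism and whose constituent homomorphisms are bijective (t2's `IsLocallyTrivial`), lying over
`P` on underlying semi-graphs, and compatible with `p`, `q` on each `Π_v`, `Π_e` UP TO AN INNER
AUTOMORPHISM of the constituent of `P` (morphisms are read "up to composition with the inner
action", §3 p. 37 / Def. 5.1 (iv) p. 63). [cite: MochizukiSemiAnbd2006, Def 3.5(i) p.37] -/
structure Hom.IsoOver (p : Hom X P) (q : Hom Y P) : Type u where
  /-- the comparison morphism `X → Y` -/
  iso : Hom X Y
  /-- its underlying morphism of semi-graphs is an isomorphism -/
  isIso_base : IsIso (C := SemiGraph.{u}) iso.base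
  /-- its constituent homomorphisms are bijective -/
  isLocallyTrivial : iso.IsLocallyTrivial
  /-- it lies over `P` -/
  base_comm : (show X.graph ⟶ Y.graph from iso.base) ≫ (show Y.graph ⟶ P.graph from q.base) = p.base
  /-- compatibility with the structure morphisms on vertex groups, up to conjugation -/
  hV_comm : ∀ v : X.graph.Vertex, ∃ g : P.Gv (p.base.vertexMap v), ∀ x : X.Gv v,
    P.castGv (show q.base.vertexMap (iso.base.vertexMap v) = p.base.vertexMap v by
        rw [← base_comm]; rfl)
      (q.hV (iso.base.vertexMap v) (iso.hV v x)) = g * p.hV v x * g⁻¹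
  /-- compatibility with the structure morphisms on edge groups, up to conjugation -/
  hE_comm : ∀ e : X.graph.Edge, ∃ g : P.Ge (p.base.edgeMap e), ∀ x : X.Ge e,
    P.castGe (show q.base.edgeMap (iso.base.edgeMap e) = p.base.edgeMap e by
        rw [← base_comm]; rfl)
      (q.hE (iso.base.edgeMap e) (iso.hE e x)) = g * p.hE e x * g⁻¹

/-- The identity is an isomorphism over `P` from `p` to `p`. [cite: MochizukiSemiAnbd2006, Def 3.5(i) p.37] -/
def Hom.IsoOver.refl (p : Hom X P) : Hom.IsoOver p p where
  iso := Hom.identity X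
  isIso_base := by change IsIso (C := SemiGraph.{u}) (𝟙 X.graph); infer_instance
  isLocallyTrivial := Hom.identity_isLocallyTrivial X
  base_comm := Category.id_comp _
  hV_comm v := ⟨1, fun x => by rw [one_mul, inv_one, mul_one]; rfl⟩
  hE_comm e := ⟨1, fun x => by rw [one_mul, inv_one, mul_one]; rfl⟩

/-- **Changing the structure morphism of the source by inner automorphisms** (same base,
conjugate constituent homomorphisms — e.g. the profinite readings of two 2-isomorphic 1-morphisms,
B2 `exists_conj_hVProfinite_of_iso2`) preserves isomorphy over `P`.
[cite: MochizukiSemiAnbd2006, Def 3.5(i) p.37] -/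
def Hom.IsoOver.of_conj {p p' : Hom X P} {q : Hom Y P} (I : Hom.IsoOver p q)
    (hbase : p'.base = p.base)
    (hV : ∀ v, ∃ g : P.Gv (p.base.vertexMap v), ∀ x,
      P.castGv (congrArg (fun k : X.graph ⟶ P.graph => k.vertexMap v) hbase) (p'.hV v x) =
        g * p.hV v x * g⁻¹)
    (hE : ∀ e, ∃ g : P.Ge (p.base.edgeMap e), ∀ x,
      P.castGe (congrArg (fun k : X.graph ⟶ P.graph => k.edgeMap e) hbase) (p'.hE e x) =
        g * p.hE e x * g⁻¹) :
    Hom.IsoOver p' q := by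
  obtain ⟨pb, pV, pE, pc⟩ := p'
  cases hbase
  exact
    { iso := I.iso
      isIso_base := I.isIso_base
      isLocallyTrivial := I.isLocallyTrivial
      base_comm := I.base_comm
      hV_comm := fun v => by
        obtain ⟨g, hg⟩ := I.hV_comm v
        obtain ⟨k, hk⟩ := hV v
        refine ⟨g * k⁻¹, fun x => ?_⟩
        have hk' : pV v x = k * p.hV v x * k⁻¹ := by simpa using hk x
        rw [hg x, hk']; group
      hE_comm := fun e => by
        obtain ⟨g, hg⟩ := I.hE_comm e
        obtain ⟨k, hk⟩ := hE e
        refine ⟨g * k⁻¹, fun x => ?_⟩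
        have hk' : pE e x = k * p.hE e x * k⁻¹ := by simpa using hk x
        rw [hg x, hk']; group }

end ProfiniteSemiGraph

/-! ### Tempered arrows of `SgA` -/

namespace SgAQuot.SgA

open SemiGraphOfAnabelioids ProfiniteSemiGraph

variable {H G : SgA.{u, u, u}}

/-- A representative 1-morphism of the arrow `f` of `SgA` (arrows are 2-isomorphism classes of
1-morphisms, Rmk 2.4.2). [cite: MochizukiSemiAnbd2006, Rmk 2.4.2, p. 26] -/
def repHomOver (f : H ⟶ G) : HomOver H.toSgA G.toSgA f.hom.hom.base := Quotient.out f.hom.hom.cls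

/-- The representative represents. [cite: MochizukiSemiAnbd2006, Rmk 2.4.2, p. 26] -/
theorem homMk_repHomOver (f : H ⟶ G) : homMk (repHomOver f) = f.hom.hom := by
  unfold repHomOver
  rcases hf : f.hom.hom with ⟨b, c⟩
  change (⟨b, Quotient.mk _ (Quotient.out c)⟩ : SgAQuot.Hom _ _) = ⟨b, c⟩
  rw [Quotient.out_eq]

/-- **Def. 3.5 (ii) on arrows of `SgA`: `f : H → G` is a TEMPERED COVERING of `G`** — read on the
profinite presentations (B1 `toProfinite`, B2 `HomOver.toProfinite` of a representative), `f` is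
isomorphic OVER `G.toProfinite` to the covering `G_S → G` (`CovObj.coveringHom`) attached to some
TEMPERED object `S` of `B^cov(G.toProfinite)` ("the covering `𝒢' → 𝒢`, as well as the object of
`B^cov(𝒢)` that gave rise to this covering, is tempered").  Independent of the representative
(`isTemperedCoveringOf_indep`). [cite: MochizukiSemiAnbd2006, Def 3.5(ii) p.37] -/
def IsTemperedCoveringOf (f : H ⟶ G) : Prop :=
  ∃ S : CovObj G.toSgA.toProfinite, S.IsTempered ∧
    Nonempty (Hom.IsoOver (repHomOver f).toProfinite S.coveringHom)

/-- The same, for an ARBITRARY representative 1-morphism of `f` (used to prove independence).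
[cite: MochizukiSemiAnbd2006, Def 3.5(ii) p.37] -/
def IsTemperedCoveringVia (f : H ⟶ G) (φ : HomOver H.toSgA G.toSgA f.hom.hom.base) : Prop :=
  ∃ S : CovObj G.toSgA.toProfinite, S.IsTempered ∧ Nonempty (Hom.IsoOver φ.toProfinite S.coveringHom)

/-- **Independence of the representative**: 2-isomorphic 1-morphisms over the base of `f` are
tempered coverings together (their profinite readings have the same base and CONJUGATE constituent
homomorphisms, B2). [cite: MochizukiSemiAnbd2006, Def 3.5(ii) p.37] -/
theorem isTemperedCoveringVia_of_iso2 (f : H ⟶ G) {φ φ' : HomOver H.toSgA G.toSgA f.hom.hom.base}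
    (σ : HomOver.Iso2 φ φ') (h : IsTemperedCoveringVia f φ) : IsTemperedCoveringVia f φ' := by
  obtain ⟨S, hS, ⟨I⟩⟩ := h
  refine ⟨S, hS, ⟨I.of_conj rfl (fun v => ?_) (fun e => ?_)⟩⟩
  · obtain ⟨g, hg⟩ := HomOver.exists_conj_hVProfinite_of_iso2 σ v
    exact ⟨g, fun x => hg x⟩
  · obtain ⟨g, hg⟩ := HomOver.exists_conj_hEAt_of_iso2 σ e
    exact ⟨g, fun x => hg x⟩

/-- `IsTemperedCoveringOf f` is `IsTemperedCoveringVia f` at the chosen representative.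
[cite: MochizukiSemiAnbd2006, Def 3.5(ii) p.37] -/
theorem isTemperedCoveringOf_iff_via (f : H ⟶ G) :
    IsTemperedCoveringOf f ↔ IsTemperedCoveringVia f (repHomOver f) := Iff.rfl

/-- **Independence of the representative**: for ANY 1-morphism `φ` in the class `f`,
`f` is a tempered covering iff `φ` reads as one. [cite: MochizukiSemiAnbd2006, Def 3.5(ii) p.37] -/
theorem isTemperedCoveringOf_indep (f : H ⟶ G) (φ : HomOver H.toSgA G.toSgA f.hom.hom.base)
    (hφ : homMk φ = f.hom.hom) : IsTemperedCoveringOf f ↔ IsTemperedCoveringVia f φ := by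
  have hrep : homMk (repHomOver f) = homMk φ := (homMk_repHomOver f).trans hφ.symm
  obtain ⟨σ⟩ := (homMk_eq_homMk_iff _ _).mp hrep
  exact ⟨isTemperedCoveringVia_of_iso2 f σ, isTemperedCoveringVia_of_iso2 f σ.symm⟩

end SgAQuot.SgA

end Literature.AnabelianGeometry.SemiGraphs

end
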